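import Summits.BirchSwinnertonDyer.BirchSwinnertonDyer.Theorems.GoldfeldAllTwistsTwoConverseTwinGenusOddMultipleWitness
import Literature.NumberTheory.EllipticCurves.RingClassFieldGenusDiscriminantProofs
import HarnessLib

set_option linter.dupNamespace false
set_option autoImplicit false

/-!
# LINE B49, genus assembly G5b-(R) at the Hilbert class field `K[1] ⊂ ℂ`: the square root `√q ∈ K[1]`
# DISCHARGED (Cox Thm. 6.1), so the genus-point input follows from a conductor-one point `y₁ ∈ X₀(49)(K[1])`,
# the trace relation and Theorem A alone

Cell `bsd-goldfeld`, seat `bsd-goldfeld-s1p-c3` (prover, gen 6); TARGET v5.2 §2 c3 (e). Support for item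
`stmt-BirchSwinnertonDyer-19140` (crux twin″ `Theses.GoldfeldAllTwistsTwoConverse.BSDTwoCMSevenAdditiveRankOne`).
Clean cone. HONEST FRAMING: nothing about BSD or `L`-values is asserted. This is
`genusPointOddMultiple_witness` (`…TwinGenusOddMultipleWitness`) with `L = K[1] = ringClassField K ι 1`, the
Hilbert class field of `K = ℚ(√−q)` realised in `ℂ` (finite Galois over `K`:
`finiteDimensional_and_isGalois_ringClassField`), in which `√q` lies by the genus theory of the maximal order
(`sqrt_mem_ringClassField_one_of_discr_eq`, `RingClassFieldGenusDiscriminantProofs`). What remains as binders is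
exactly: the point `y₁ ∈ X₀(49)(K[1])` (for the conductor-one Heegner point: Darmon 2004 Thm. 3.6, tree fact
`phi_heegnerTau_mem_singularModuliField` via `exists_map_eq_heegnerPointComplexOfConductor_one`), the TRACE
RELATION `P = n • Σ_{σ ∈ Gal(K[1]/K)} σ y₁` (Gross 1991 (4.1), Shimura reciprocity), and THEOREM A in Galois-sum
currency (explicit Gross–Zagier for the genus character: `CaiShuTian2014.thm11_ringClassChar` at `c = 1` +
`Gross2004.rankinLSeries_eq_mul_quadraticTwist` + CLTZ Thm 1.2 + BSD₂ of the `784`-partner — the cell's G5b-(A)).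

References: D. A. Cox (2013) Thm. 6.1 [Cox2013]; B. Gross (1991) §4 (4.1) [GrossLMS1991]; H. Darmon (2004)
Thm. 3.6 [Darmon2004]; L. Cai, J. Shu, Y. Tian (2014) Thm. 1.1 [CaiShuTian2014].
-/

noncomputable section

open scoped Classical

open WeierstrassCurve Literature.NumberTheory.EllipticCurves
  Literature.NumberTheory.EllipticCurves.ModularForms

namespace Summit.BirchSwinnertonDyer.BirchSwinnertonDyer.Theorems.GoldfeldGoodTwists

variable {K : Type} [Field K] [NumberField K]

-- `…TwinGenusOddMultipleWitness` is stated for an abstract field `L`, whose point group and weights carry the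
-- classical decidability instances; `K[1] ⊂ ℂ` inherits decidability from `ℂ`, so we elaborate this file in
-- the classical instance world to apply that theorem verbatim.
attribute [local instance 2000] Classical.propDecidable

/-- **The genus-point input at `(q, K, P)` from a conductor-one point over the Hilbert class field.** Let `q`
be a prime with `q ≡ 1 (mod 4)`, `K` imaginary quadratic with `d_K = −4q`, `ι : K → ℂ`, `K[1] ⊂ ℂ` the Hilbert
class field (`ringClassField K ι 1`; finite Galois over `K` — instance binders, discharged by
`finiteDimensional_and_isGalois_ringClassField`), `P ∈ X₀(49)(K)`, `y₁ ∈ X₀(49)(K[1])` with the trace relation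
`P = n • Σ_{σ ∈ Gal(K[1]/K)} σ y₁` (`n ≠ 0`), and assume Theorem A in Galois-sum currency for the quadratic
character of any `r₀ ∈ K[1]` with `r₀² = q` (such `r₀` EXISTS: `sqrt_mem_ringClassField_one_of_discr_eq`). Then
the `∃`-clause of `X049GenusPointOddMultiple` holds at `(q, K, P)`.
[cite: Cox2013, §6.A Thm. 6.1] [cite: GrossLMS1991, §4 (4.1)] [cite: Darmon2004, Thm. 3.6] -/
theorem genusPointOddMultiple_witness_hilbertClassField (hK : IsImaginaryQuadratic K) {q : ℕ} (hq : q.Prime)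
    (hq4 : q % 4 = 1) (hdK : NumberField.discr K = -(4 * (q : ℤ))) (ι : K →+* ℂ)
    [FiniteDimensional K (ringClassField K ι 1)] [IsGalois K (ringClassField K ι 1)]
    (P : (cm7.baseChange K).toAffine.Point)
    (y₁ : (cm7.baseChange (ringClassField K ι 1)).toAffine.Point) {n : ℤ} (hn : n ≠ 0)
    (htr : Affine.Point.map (algebraMap K (ringClassField K ι 1)).toRatAlgHom P =
      n • ∑ σ : ringClassField K ι 1 ≃ₐ[K] ringClassField K ι 1,
        Affine.Point.map (σ : ringClassField K ι 1 →ₐ[K] ringClassField K ι 1) y₁)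
    (hA : ∀ r₀ : ringClassField K ι 1, (r₀ : ℂ) ^ 2 = (q : ℂ) →
      ∃ (i : ringClassField K ι 1) (hi : (cm7.baseChange (ringClassField K ι 1)).toAffine.Nonsingular 0 i)
        (μ l : ℤ), Odd l ∧
        IsOfFinAddOrder (μ • (∑ σ : ringClassField K ι 1 ≃ₐ[K] ringClassField K ι 1,
          (if σ r₀ = r₀ then (1 : ℤ) else -1) •
            Affine.Point.map (σ : ringClassField K ι 1 →ₐ[K] ringClassField K ι 1) y₁) -
          l • Affine.Point.some 0 i hi)) :
    ∃ (H₀ : Type) (_ : Field H₀) (_ : CharZero H₀) (_ : Algebra K H₀) (i₀ : H₀)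
      (hg : (cm7.baseChange H₀).toAffine.Nonsingular 0 i₀)
      (y yχ Z : (cm7.baseChange H₀).toAffine.Point) (n μ l : ℤ),
      Module.finrank K H₀ = 2 ∧ n ≠ 0 ∧ Odd l ∧
      Affine.Point.map (algebraMap K H₀).toRatAlgHom P = n • y ∧
      IsOfFinAddOrder (y - yχ - (2 : ℤ) • Z) ∧
      IsOfFinAddOrder (μ • yχ - l • Affine.Point.some 0 i₀ hg) := by
  -- `√q ∈ K[1]` (genus theory of the maximal order)
  obtain ⟨s, hs⟩ := IsAlgClosed.exists_pow_nat_eq (q : ℂ) two_pos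
  have hmem : s ∈ ringClassField K ι 1 := sqrt_mem_ringClassField_one_of_discr_eq hK ι hq hq4 hdK s hs
  set r₀ : ringClassField K ι 1 := ⟨s, hmem⟩ with hr₀
  have hr : r₀ ^ 2 = algebraMap K (ringClassField K ι 1) ((q : ℕ) : K) := by
    apply Subtype.ext
    rw [map_natCast]
    simpa using hs
  exact genusPointOddMultiple_witness hK hq hdK P hr y₁ hn htr (hA r₀ hs)

end Summit.BirchSwinnertonDyer.BirchSwinnertonDyer.Theorems.GoldfeldGoodTwists

end
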